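import Summits.KontsevichZagierPeriods.KontsevichZagierPeriods.Theorems.LiouvilleUnfoldingLogPrimitiveNLStubConeDecompositionAux

/-!
# `LogPrimitiveNL` (stmt-KontsevichZagierPeriods-2836, route LiouvilleUnfolding) — line
`logderiv-peeling`, stub `stub_coneDecomposition`

**Cone decomposition** (pure finite-dimensional linear algebra). For integer vectors
`f₁, …, f_R ∈ ℤᵏ` there are finitely many "simplicial charts" `a`, each with a positive integer
`N a`, integer rows `b a l ∈ ℤᵏ` and natural exponents `A a i l` with every column `(A a · l)`
orthogonal to all `f_r`, such that every nonnegative real `ℓ` orthogonal to all `f_r` lies in some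
chart: `b a l · ℓ ≥ 0` for all `l` and `N a · ℓᵢ = ∑_l A a i l · (b a l · ℓ)`.

Construction. The auxiliary file provides a finite stock of nonnegative integer kernel vectors
`G S` (`S ⊆ Fin k`) generating the cone `P = ker ∩ ℝᵏ_{≥0}` (`cone_generation`) and conic
Carathéodory (`cone_exists_indep_rep`). Charts are indexed by the sets `T` of generators: when
the family `(G S)_{S ∈ T}` is `ℚ`-linearly independent it has a rational left inverse
(`cone_exists_leftInv`, from `LinearMap.exists_leftInverse_of_injective`), i.e. rational rows `β_S`
with `β_S · G S' = δ_{S S'}`; `N_T` is a common denominator and `b_T S = N_T β_S ∈ ℤᵏ`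
(`cone_exists_chart`), `A_T i S = (G S)ᵢ` for `S ∈ T` and `0` otherwise. A real `ℓ ∈ P` is
`∑_{S ∈ T} λ_S G S` with `λ ≥ 0` and `T` independent (over `ℝ`, hence over `ℚ`), and then
`b_T S · ℓ = N_T λ_S ≥ 0` and `∑_S A_T i S (b_T S · ℓ) = N_T ℓᵢ`. Dependent `T` get the trivial
chart `N = 1, b = 0`; the empty `T` covers `ℓ = 0`; `k = 0` and `R = 0` need no special care.
Finally `Finset (Finset (Fin k))` and `Finset (Fin k)` are enumerated by `Fin m`, `Fin p`.
[folklore]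
-/

noncomputable section

open Finset

namespace Summit.KontsevichZagierPeriods.LiouvilleUnfolding.LogPrimitiveNL

variable {k R : ℕ}

/-- **Rational left inverse of an independent family.** If the rational vectors `(w j)_{j ∈ T}`
admit no nontrivial rational dependence, there are rational rows `β j` (`j ∈ T`, and `β j = 0`
off `T`) with `β j · w j' = δ_{j j'}` for `j, j' ∈ T` (a linear left inverse of the injective
combination map `(T → ℚ) → ℚⁿ`, read on the standard basis). -/
theorem cone_exists_leftInv {ι : Type*} [Fintype ι] [DecidableEq ι] {n : ℕ} (w : ι → Fin n → ℚ)
    (T : Finset ι)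
    (hT : ∀ μ : ι → ℚ, (∀ j, j ∉ T → μ j = 0) → (∀ i, ∑ j, μ j * w j i = 0) → ∀ j, μ j = 0) :
    ∃ β : ι → Fin n → ℚ, (∀ j, j ∉ T → β j = 0) ∧
      ∀ j ∈ T, ∀ j' ∈ T, ∑ i, β j i * w j' i = if j = j' then 1 else 0 := by
  classical
  let Φ : (T → ℚ) →ₗ[ℚ] (Fin n → ℚ) := Fintype.linearCombination ℚ (fun j : T => w j)
  have hker : LinearMap.ker Φ = ⊥ := by
    rw [LinearMap.ker_eq_bot']
    intro x hx
    let μ : ι → ℚ := fun j => if h : j ∈ T then x ⟨j, h⟩ else 0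
    have hμ : ∀ i, ∑ j, μ j * w j i = 0 := by
      intro i
      have h1 : (Φ x) i = 0 := by rw [hx]; rfl
      rw [Fintype.linearCombination_apply, Finset.sum_apply] at h1
      simp only [Pi.smul_apply, smul_eq_mul] at h1
      calc ∑ j, μ j * w j i = ∑ j ∈ T, μ j * w j i :=
            (Finset.sum_subset (Finset.subset_univ T) fun j _ hj => by simp [μ, hj]).symm
        _ = ∑ j : T, μ j * w j i := (Finset.sum_coe_sort _ _).symm
        _ = ∑ j : T, x j * w j i := Finset.sum_congr rfl fun j _ => by simp [μ, j.2]
        _ = 0 := h1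
    ext j
    simpa [μ, j.2] using hT μ (fun j hj => dif_neg hj) hμ j
  obtain ⟨Ψ, hΨ⟩ := Φ.exists_leftInverse_of_injective hker
  have hΨΦ : ∀ x, Ψ (Φ x) = x := fun x => by
    rw [← LinearMap.comp_apply, hΨ, LinearMap.id_apply]
  refine ⟨fun j i => if h : j ∈ T then Ψ (Pi.single i 1) ⟨j, h⟩ else 0, fun j hj => ?_,
    fun j hj j' hj' => ?_⟩
  · ext i
    simp [hj]
  · simp only [dif_pos hj]
    have h1 : ∑ i, Ψ (Pi.single i 1) ⟨j, hj⟩ * w j' i = Ψ (w j') ⟨j, hj⟩ := by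
      have hw : w j' = ∑ i, w j' i • (Pi.single i (1 : ℚ) : Fin n → ℚ) := by
        ext i
        simp [Finset.sum_apply, Pi.single_apply]
      conv_rhs => rw [hw, map_sum, Finset.sum_apply]
      refine Finset.sum_congr rfl fun i _ => ?_
      rw [map_smul, Pi.smul_apply, smul_eq_mul, mul_comm]
    have h2 : w j' = Φ (Pi.single ⟨j', hj'⟩ 1) := by
      simp only [Φ, Fintype.linearCombination_apply_single, one_smul]
    rw [h1, h2, hΨΦ, Pi.single_apply]
    simp only [Subtype.mk.injEq]

/-- **Chart data.** For a set `T` of generators there are `N ≥ 1` and integer rows `b S`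
(`S ⊆ Fin k`) such that, IF the family `(G S)_{S ∈ T}` has no nontrivial rational dependence,
then for every real combination `ℓ = ∑_{S ∈ T} coef S • G S` one has
`b S · ℓ = N · coef S` for all `S` (both sides vanish off `T`): `b = N β` for the rational left
inverse `β` of `cone_exists_leftInv` and a common denominator `N`. (For dependent `T`: `N = 1`,
`b = 0`, and the implication is vacuous.) -/
theorem cone_exists_chart (G : Finset (Fin k) → Fin k → ℕ) (T : Finset (Finset (Fin k))) :
    ∃ (N : ℕ) (b : Finset (Fin k) → Fin k → ℤ), 0 < N ∧
      ((∀ μ : Finset (Fin k) → ℚ, (∀ S, S ∉ T → μ S = 0) →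
          (∀ i, ∑ S, μ S * (G S i : ℚ) = 0) → ∀ S, μ S = 0) →
        ∀ (coef : Finset (Fin k) → ℝ) (ℓ : Fin k → ℝ), (∀ S, S ∉ T → coef S = 0) →
          (∀ i, ℓ i = ∑ S, coef S * (G S i : ℝ)) →
            ∀ S, ∑ i, (b S i : ℝ) * ℓ i = N * coef S) := by
  classical
  by_cases hT : ∀ μ : Finset (Fin k) → ℚ, (∀ S, S ∉ T → μ S = 0) →
      (∀ i, ∑ S, μ S * (G S i : ℚ) = 0) → ∀ S, μ S = 0
  · obtain ⟨β, hβ0, hβ⟩ := cone_exists_leftInv (fun S i => (G S i : ℚ)) T hT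
    obtain ⟨N, hN, b, hb⟩ :=
      cone_exists_int_eq_nat_mul fun q : Finset (Fin k) × Fin k => β q.1 q.2
    refine ⟨N, fun S i => b (S, i), hN, fun _ coef ℓ hcoef hℓ S => ?_⟩
    have hb' : ∀ i, ((b (S, i) : ℤ) : ℝ) = (N : ℝ) * ((β S i : ℚ) : ℝ) := fun i => by
      have := hb (S, i)
      exact_mod_cast this
    have e1 : ∑ i, (b (S, i) : ℝ) * ℓ i =
        (N : ℝ) * ∑ S', coef S' * ((∑ i, β S i * (G S' i : ℚ) : ℚ) : ℝ) := by
      calc ∑ i, (b (S, i) : ℝ) * ℓ i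
            = ∑ i, ∑ S', (N : ℝ) * ((β S i : ℚ) : ℝ) * (coef S' * (G S' i : ℝ)) := by
              simp_rw [hb', hℓ, Finset.mul_sum]
        _ = ∑ S', ∑ i, (N : ℝ) * ((β S i : ℚ) : ℝ) * (coef S' * (G S' i : ℝ)) :=
              Finset.sum_comm
        _ = (N : ℝ) * ∑ S', coef S' * ((∑ i, β S i * (G S' i : ℚ) : ℚ) : ℝ) := by
              push_cast
              simp_rw [Finset.mul_sum]
              exact Finset.sum_congr rfl fun S' _ => Finset.sum_congr rfl fun i _ => by ring
    rw [e1]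
    congr 1
    by_cases hS : S ∈ T
    · rw [Finset.sum_eq_single S]
      · rw [hβ S hS S hS, if_pos rfl]
        push_cast
        ring
      · intro S' _ hS'S
        by_cases hS' : S' ∈ T
        · rw [hβ S hS S' hS', if_neg (Ne.symm hS'S)]
          simp
        · rw [hcoef S' hS']
          simp
      · simp
    · rw [hcoef S hS]
      refine Finset.sum_eq_zero fun S' _ => ?_
      rw [hβ0 S hS]
      simp
  · exact ⟨1, 0, one_pos, fun h => absurd h hT⟩

/-- **Cone decomposition** (registered stub `stub_coneDecomposition` of crux
stmt-KontsevichZagierPeriods-2836, line `logderiv-peeling`; finite-dimensional, no analysis): for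
integer vectors `f₁, …, f_R ∈ ℤᵏ` there are finitely many "simplicial charts" `a`, each with a
positive integer `N a`, integer rows `b a l ∈ ℤᵏ` (`l < p`) and natural exponents `A a i l`, every
column `(A a · l)` orthogonal to all `f_r`, such that every nonnegative real vector `ℓ` orthogonal
to all `f_r` lies in some chart: `b a l · ℓ ≥ 0` for all `l` and
`N a · ℓ_i = Σ_l A a i l · (b a l · ℓ)` for all `i`. Charts = sets `T` of the integer generators
`G S` (`cone_generation`) of `ker F ∩ ℝᵏ_{≥0}`; `A` = the generators of `T`; `b` = `N ×` a rational
left inverse when `T` is independent (`cone_exists_chart`); covering by `cone_generation`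
(generation) and `cone_exists_indep_rep` (conic Carathéodory). -/
theorem stub_coneDecomposition :
    ∀ (k R : ℕ) (f : Fin R → Fin k → ℤ),
      ∃ (m p : ℕ) (N : Fin m → ℕ) (b : Fin m → Fin p → Fin k → ℤ) (A : Fin m → Fin k → Fin p → ℕ),
        (∀ a, 0 < N a) ∧
        (∀ a l r, ∑ i, f r i * (A a i l : ℤ) = 0) ∧
        ∀ ℓ : Fin k → ℝ, (∀ i, 0 ≤ ℓ i) → (∀ r, ∑ i, (f r i : ℝ) * ℓ i = 0) →
          ∃ a, (∀ l, 0 ≤ ∑ i, (b a l i : ℝ) * ℓ i) ∧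
            ∀ i, (N a : ℝ) * ℓ i = ∑ l, (A a i l : ℝ) * ∑ i', (b a l i' : ℝ) * ℓ i' := by
  intro k R f
  classical
  obtain ⟨G, hGker, hGrep⟩ := cone_generation k R f
  choose Nc bc hNc hchart using fun T : Finset (Finset (Fin k)) => cone_exists_chart G T
  let e₁ := Fintype.equivFin (Finset (Finset (Fin k)))
  let e₂ := Fintype.equivFin (Finset (Fin k))
  refine ⟨Fintype.card (Finset (Finset (Fin k))), Fintype.card (Finset (Fin k)),
    fun a => Nc (e₁.symm a), fun a l => bc (e₁.symm a) (e₂.symm l),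
    fun a i l => if e₂.symm l ∈ e₁.symm a then G (e₂.symm l) i else 0,
    fun a => hNc _, fun a l r => ?_, fun ℓ hℓ0 hℓK => ?_⟩
  · -- orthogonality of the columns
    by_cases h : e₂.symm l ∈ e₁.symm a
    · simp only [if_pos h]
      exact hGker _ r
    · simp [if_neg h]
  · -- covering
    obtain ⟨coef, hcoef0, hrep⟩ := hGrep ℓ hℓ0 hℓK
    obtain ⟨lam, hlam0, hrep', hind⟩ :=
      cone_exists_indep_rep (fun S i => (G S i : ℝ)) ℓ coef hcoef0 hrep
    let T : Finset (Finset (Fin k)) := univ.filter fun S => lam S ≠ 0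
    have hTc : ∀ S, S ∉ T → lam S = 0 := fun S hS => by simpa [T] using hS
    have hTind : ∀ μ : Finset (Fin k) → ℚ, (∀ S, S ∉ T → μ S = 0) →
        (∀ i, ∑ S, μ S * (G S i : ℚ) = 0) → ∀ S, μ S = 0 := by
      intro μ hμT hμ S
      have h1 : ∀ S, lam S = 0 → (μ S : ℝ) = 0 := fun S hS => by
        rw [hμT S (by simpa [T] using hS), Rat.cast_zero]
      have h2 : ∀ i, ∑ S, (μ S : ℝ) * (G S i : ℝ) = 0 := fun i => by
        have := congrArg (Rat.cast : ℚ → ℝ) (hμ i)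
        push_cast at this
        exact this
      exact_mod_cast hind (fun S => (μ S : ℝ)) h1 h2 S
    have key := hchart T hTind lam ℓ hTc hrep'
    refine ⟨e₁ T, fun l => ?_, fun i => ?_⟩
    · dsimp only
      rw [Equiv.symm_apply_apply, key]
      exact mul_nonneg (Nat.cast_nonneg _) (hlam0 _)
    · dsimp only
      simp_rw [Equiv.symm_apply_apply, key]
      rw [Equiv.sum_comp e₂.symm
        (fun S => ((if S ∈ T then G S i else 0 : ℕ) : ℝ) * ((Nc T : ℝ) * lam S))]
      rw [hrep' i, Finset.mul_sum]
      refine Finset.sum_congr rfl fun S _ => ?_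
      by_cases hS : S ∈ T
      · simp only [if_pos hS]
        ring
      · simp [if_neg hS, hTc S hS]

end Summit.KontsevichZagierPeriods.LiouvilleUnfolding.LogPrimitiveNL
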